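/-
Copyright: cell pub-balaban-gaps, seat ne8 (estimate NE7c), gen 18. Project licence.
-/
import Summits.QuantumFields.BalabanUV.T4Continuum.Spine.NE7c.LiveFactorJointLawModel
import Summits.QuantumFields.BalabanUV.T4Continuum.Spine.NE7c.LiveFactorAdaptiveCascade

/-!
# Road (δ)'s END-TO-END constructor FIRES on ADAPTIVE DECISION TREES under ANY JOINT LAW (history-dependent booking of ≤ `ν_σ` sharp threshold tests per
# live stage = reading (R) + count (W1) of `T4ShellMeasure` §8; arbitrarily dependent real observables on any probability space per run and comparison):
# `T4IndicatorShell.ShellWeightBound` BY NAME with the tree's cascade constant `V = 2(∏_σ(ν_σ + 1) − 1)`, ceiling `(V·4c₁∕β′)·ϑ^K` for both runs, and the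
# level-0 LATTICE instance (any adaptive tree of plaquette tests on the Wilson–Gibbs fields of any torus scheme) (row NE7c; junction J-26b; MODEL,
# [folklore]) — the MODEL side of road (δ) is thereby complete: files 37 ⊂ 38 ⊂ 47 (fixed battery, `V = S`) ⊂ THIS (any adaptive tree; `V` sharp by file 39)

Cell `pub-balaban-gaps` (G2), seat ne8, estimate **NE7c** (`T4IndicatorShell.ShellWeightBound`; two-run artefact, NOT PRINTED in [Bałaban 1983–89], NOT
PROVED).  Proof-only file under `Spine/NE7c/`: imports this seat's files 47 `LiveFactorJointLawModel` (generic cell lemmas, `realizedLedger_slots`; through it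
`T4GenFunBounds.gibbsMeasure`, `Missing.TorusScheme`, `Missing.plaqLoop`) and 49 `LiveFactorAdaptiveCascade` (`sum_card_shell_le_cascade`); the tree's
`T4ShellMeasure` (`exists_liveFactor_choice_function`, `shellWeightBound_of_realized`, `candidateCount_spec`, `candidateTotals_le_of_pointwise`, `twoSidedShell`)
BY NAME.  Nothing of Bałaban's is named; no `def` (paths are bare `Nat.rec`); classical decidability; 0 `sorry`.

THE QUESTION (`T4ShellMeasure` §8: «What this member needs of the expansion is ONLY the reading (R) and the per-stage count (W1)»; files 37∕38∕47 inhabited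
the constructor's hypothesis list by NON-adaptive batteries, file 39 showed the count is attained by an adaptive tree, file 49 proved the count pointwise for
genuine threshold tests along the genuine adaptive path).  Does the END-TO-END constructor fire on measure-valued two-run data generated by an ARBITRARY
ADAPTIVE tree — ≤ `ν_σ` booked tests per live stage GIVEN THE HISTORY, booked set and next value arbitrary functions of the older value — under an ARBITRARY
joint law, with the tree's constant `V`?  And on the lattice?

ANSWER ([folklore]): yes.
* §1 **`shellWeightBound_slots_of_totals`** — file 47's abstract constructor with the per-slot disjointness replaced by a bound `V ≥ 0` on the CANDIDATE-SUMMED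
  TOTALS `Σ_{i<n_K} Σ_s Σ_τ piece^X ≤ V` (the currency the cascade delivers): ONE `i⋆`, both runs' chosen totals `≤ (V·4c₁∕β′)·ϑ^K`, `ShellWeightBound` BY NAME.
* §2 `mem_cell_iff` — `x ∈ cell_ω` iff `ω` is `x`'s outcome vector `t ↦ (u_t x < a_t)`.
* §3 `sum_indicator_le_count` (pointwise: summed over cells `ω` and slots `(σ, t)`, the indicators of «`x ∈ cell_ω`, `t` booked at `σ` on the path of `ω`,
  `u_t(x)` in its shell» are `≤ Σ_{σ<S} #{t ∈ tests σ (path(ω_x) σ) : u_t(x) ∈ shell}` — only `x`'s own cell contributes); **`candidateTotal_le`** — under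
  ANY probability law: `Σ_{i<n} Σ_{(σ,t)} Σ_ω P(cell_{i,ω} ∩ {t booked at σ on path(ω), u_t ∈ shell_{t,i}}) ≤ 2·∏_{σ<S}(ν_σ+1) − 2` (masses → `lintegral`s of
  indicators → `lintegral_finsetSum` → §3 pointwise + file 49's cascade → `candidateTotals_le_of_pointwise`).
* §4 **`shellWeightBound_adaptiveTree`** — every `K`, run `X` on its own probability space, finite label set `τ`, measurable `u^X_{K,t}` (ANY dependence),
  `θ_{K,t} ≥ 0`, radii `2ρ^X_{K,t} ≤ c₁ϑ^K`, its own adaptive tree booking ≤ `ν_σ` tests per stage (`ν` independent of `K` and run): ONE choice function, both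
  runs' chosen booked-shell mass `≤ ((2∏_{σ<S}(ν_σ+1) − 2)·4c₁∕β′)·ϑ^K`, `T4IndicatorShell.ShellWeightBound` BY NAME (§1 at `A = P(cell)`, `piece_{(σ,t)} =
  P(cell ∩ {t booked at σ, u_t ∈ shell})`, `sh = P(cell ∩ ⋃ …)`, `V = 2∏(ν_σ+1) − 2`).
* §5 **`shellWeightBound_wilsonScheme_adaptive`** — §4 on the Wilson–Gibbs measures `T4GenFunBounds.gibbsMeasure` of consecutive steps of ANY
  `Missing.TorusScheme G O` (`β_K ≥ 0`, any regular `G`), tests `1 − Re tr U(∂p_t)`, ANY adaptive tree of plaquette tests per run.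

WHAT THIS SHOWS ∕ DOES NOT SHOW (honest).  SHOWS: the (δ-1) member's ENTIRE hypothesis list — (R), (W1), the candidate-summed cascade bound, realized ledgers
for every choice function — is inhabited at MEASURE LEVEL by ARBITRARY adaptive sharp-threshold trees under ARBITRARY laws, also on the lattice at level 0; the
constructor consumes of the laws σ-additivity only, of the tree only `#tests ≤ ν_σ`; the constant is the tree's `V` (sharp: file 39).  DOES NOT SHOW: WHICH
tree Bałaban's expansion [B14] (2.18) is (node O: its stages, tested variables `sup_p |U_{k,□}(V_k,∂p) − 1|` of the block-averaged minimisers, outcome maps,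
the numbers `ν_σ`, `S` as Lean objects), (L1-step), two-run closeness (U1b ∕ NE3).  BY-NAME EFFECT ON THE WALL: none (MODEL).  VERDICT WORD UNCHANGED:
WORK-bound behind node O; INSTANCE 0∕1.  NE7c ∕ NE7b NOT PRINTED ∕ NOT PROVED; spine 0∕9; one finite T⁴ — NOT ℝ⁴, NOT infinite volume, NOT the mass gap, NOT Clay.
HONEST DEPENDENCY (cell): continuum YM on T⁴ ⇐ BetaPertH ∧ nine spine estimates (0∕9 proved); BetaPertH ⇐ (D1) ∧ (D4) ∧ CAP+tail.
-/

set_option autoImplicit false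

noncomputable section

open MeasureTheory Finset Set
open scoped Classical ENNReal
open Literature.MathematicalPhysics.QuantumFieldTheory.Balaban1983to89
open Literature.MathematicalPhysics.QuantumFieldTheory.Balaban1983to89.T4ShellMeasure
open Summit.QuantumFields.BalabanUV.T4Continuum.Spine.NE7c.LiveFactorJointLawModel
  (realizedLedger_slots cell_disjoint iUnion_cell measurableSet_cell measureReal_inter_iUnion_le sum_measureReal_cell)
open Summit.QuantumFields.BalabanUV.T4Continuum.Spine.NE7c.LiveFactorAdaptiveCascade (sum_card_shell_le_cascade)

namespace Summit.QuantumFields.BalabanUV.T4Continuum.Spine.NE7c.LiveFactorAdaptiveTreeModel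

/-! ## §1 The abstract slot system fired from candidate-summed TOTALS (`V` arbitrary) -/

section Abstract

variable {ι κ : Type*} [Fintype ι] [Fintype κ] (A sh : ℕ → ℕ → ι → ℝ) (piece : ℕ → ℕ → κ → ι → ℝ)
  (B shB : ℕ → ℕ → ι → ℝ) (pieceB : ℕ → ℕ → κ → ι → ℝ)

/-- **THE CONSTRUCTOR FROM TOTALS.**  As file 47's `shellWeightBound_slots`, but with the per-slot disjointness replaced by a bound `V` on the
CANDIDATE-SUMMED TOTALS `Σ_{i<n_K} Σ_s Σ_τ piece^X_{K,i}(s,τ) ≤ V` (the form the cascade count delivers): ONE choice function with both runs' chosen totals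
`≤ (V·4c₁∕β′)·ϑ^K` and `T4IndicatorShell.ShellWeightBound` BY NAME, `Wsh K = Σ_s Σ_τ piece^A_{K,i⋆K} + Σ_s Σ_τ piece^B_{K,i⋆K}`. [folklore] -/
theorem shellWeightBound_slots_of_totals (l₀ : ℝ) {c₁ β' ϑ V : ℝ} (hc₁ : 0 < c₁) (h2 : 2 * c₁ ≤ β') (hϑ0 : 0 < ϑ) (hϑ1 : ϑ < 1) (hV : 0 ≤ V)
    (hA0 : ∀ K i τ, 0 ≤ sh K i τ) (hAle : ∀ K i τ, sh K i τ ≤ A K i τ) (hAcov : ∀ K i τ, sh K i τ ≤ ∑ s, piece K i s τ)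
    (hpA0 : ∀ K i s τ, 0 ≤ piece K i s τ) (hA1 : ∀ K i, ∑ τ, A K i τ = 1)
    (hAtot : ∀ K, ∑ i ∈ range ⌊β' / (c₁ * ϑ ^ K)⌋₊, ∑ s, ∑ τ, piece K i s τ ≤ V)
    (hB0 : ∀ K i τ, 0 ≤ shB K i τ) (hBle : ∀ K i τ, shB K i τ ≤ B K i τ) (hBcov : ∀ K i τ, shB K i τ ≤ ∑ s, pieceB K i s τ)
    (hpB0 : ∀ K i s τ, 0 ≤ pieceB K i s τ) (hB1 : ∀ K i, ∑ τ, B K i τ = 1)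
    (hBtot : ∀ K, ∑ i ∈ range ⌊β' / (c₁ * ϑ ^ K)⌋₊, ∑ s, ∑ τ, pieceB K i s τ ≤ V) :
    ∃ istar : ℕ → ℕ, (∀ K, istar K < ⌊β' / (c₁ * ϑ ^ K)⌋₊ ∧
        ∑ s, ∑ τ, piece K (istar K) s τ ≤ (V * (4 * c₁ / β')) * ϑ ^ K ∧
        ∑ s, ∑ τ, pieceB K (istar K) s τ ≤ (V * (4 * c₁ / β')) * ϑ ^ K) ∧
      T4IndicatorShell.ShellWeightBound l₀ (fun _ => (univ : Finset ι))
        (fun K (_ : ℝ) (τ : ι) => A K (istar K) τ) (fun K (_ : ℝ) (τ : ι) => B K (istar K) τ)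
        (fun K (_ : ℝ) (τ : ι) => sh K (istar K) τ) (fun K (_ : ℝ) (τ : ι) => shB K (istar K) τ)
        (fun K => ∑ s, ∑ τ, piece K (istar K) s τ + ∑ s, ∑ τ, pieceB K (istar K) s τ) := by
  have hrate : ∀ K, 0 < ⌊β' / (c₁ * ϑ ^ K)⌋₊ ∧ (2 : ℝ) / ⌊β' / (c₁ * ϑ ^ K)⌋₊ ≤ (4 * c₁ / β') * ϑ ^ K := by
    intro K
    have hρ : 0 < c₁ * ϑ ^ K := mul_pos hc₁ (pow_pos hϑ0 K)
    have hρ2 : 2 * (c₁ * ϑ ^ K) ≤ β' := by nlinarith [pow_le_one₀ hϑ0.le hϑ1.le (n := K)]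
    obtain ⟨h1, -, h3⟩ := candidateCount_spec hρ hρ2
    exact ⟨h1, h3.trans_eq (by ring)⟩
  have hlA := fun c => realizedLedger_slots A sh piece hA0 hAle hAcov hpA0 hA1 l₀ c
  have hlB := fun c => realizedLedger_slots B shB pieceB hB0 hBle hBcov hpB0 hB1 l₀ c
  obtain ⟨istar, histar⟩ := exists_liveFactor_choice_function (fun K => ⌊β' / (c₁ * ϑ ^ K)⌋₊) (fun K => (hrate K).1)
    (fun K i => ∑ s, ∑ τ, piece K i s τ) (fun K i => ∑ s, ∑ τ, pieceB K i s τ) (fun _ => 1) (fun _ => 1)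
    (fun _ => one_pos) (fun _ => one_pos)
    (fun K i => sum_nonneg fun s _ => sum_nonneg fun τ _ => hpA0 K i s τ)
    (fun K i => sum_nonneg fun s _ => sum_nonneg fun τ _ => hpB0 K i s τ)
    hV (fun K => (hAtot K).trans_eq (mul_one V).symm) (fun K => (hBtot K).trans_eq (mul_one V).symm)
    (M := 4 * c₁ / β') (fun K => (hrate K).2)
  refine ⟨istar, fun K => ⟨(histar K).1, ?_, ?_⟩, ?_⟩
  · simpa only [mul_one, mul_assoc] using (histar K).2.1
  · simpa only [mul_one, mul_assoc] using (histar K).2.2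
  have hSWB := shellWeightBound_of_realized (hlA istar) (hlB istar)
    (fun K => by show 0 < ∑ τ, A K (istar K) τ; rw [hA1]; exact one_pos)
    (fun K => by show 0 < ∑ τ, B K (istar K) τ; rw [hB1]; exact one_pos) hϑ0.le hϑ1
    (C := V * (4 * c₁ / β'))
    (fun K => by
      show ∑ s, ∑ τ, piece K (istar K) s τ ≤ (V * (4 * c₁ / β') * ϑ ^ K) * ∑ τ, A K (istar K) τ
      rw [hA1]; simpa only [mul_one, mul_assoc] using (histar K).2.1)
    (fun K => by
      show ∑ s, ∑ τ, pieceB K (istar K) s τ ≤ (V * (4 * c₁ / β') * ϑ ^ K) * ∑ τ, B K (istar K) τ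
      rw [hB1]; simpa only [mul_one, mul_assoc] using (histar K).2.2)
  have e : (fun K => (hlA istar).omega K + (hlB istar).omega K) =
      (fun K => ∑ s, ∑ τ, piece K (istar K) s τ + ∑ s, ∑ τ, pieceB K (istar K) s τ) := by
    funext K; simp only [SlotLedger.omega, mul_zero, Real.exp_zero, one_mul]; rw [hA1, hB1]; simp only [div_one]
  rw [← e]; exact hSWB

end Abstract

/-! ## §2 Cells indexed by outcome vectors: membership is «being the outcome vector» -/

section CellsBis

variable {Ω τ : Type*}

/-- A configuration lies in the cell of the outcome vector `ω` iff `ω` IS its outcome vector `t ↦ (u_t x < a_t)`. [folklore] -/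
theorem mem_cell_iff (u : τ → Ω → ℝ) (a : τ → ℝ) (ω : τ → Bool) (x : Ω) :
    x ∈ (⋂ t, (u t) ⁻¹' (if ω t then Iio (a t) else Ici (a t))) ↔ ω = fun t => decide (u t x < a t) := by
  rw [Set.mem_iInter, funext_iff]; refine forall_congr' fun t => ?_; rw [Set.mem_preimage]; cases hω : ω t
  · simp only [Bool.false_eq_true, if_false, Set.mem_Ici]; rw [eq_comm, decide_eq_false_iff_not, not_lt]
  · simp only [if_true, Set.mem_Iio]; rw [eq_comm, decide_eq_true_iff]

end CellsBis

/-! ## §3 Under ANY law, the candidate-summed booked-shell masses of an adaptive tree are `≤ 2(∏_σ(ν_σ + 1) − 1)` -/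

section Totals

variable {Ω α τ : Type*} [Fintype τ] [DecidableEq τ] {S : ℕ}
  (u : τ → Ω → ℝ) (θ ρ : τ → ℝ) (tests : ℕ → α → Finset τ) (next : ℕ → α → Finset τ → α) (a₀ : α)

/-- POINTWISE: summed over the cells `ω` and the slots `(σ, t)`, the indicators of «`x` in cell `ω`, `t` booked at stage `σ` on the path of `ω`, `u_t(x)` in its
shell» count the booked tests of `x`'s OWN path found in their shells (only the cell of `x`'s outcome vector contributes). [folklore] -/
theorem sum_indicator_le_count {ρstar : ℝ} (i : ℕ) (x : Ω) :
    ∑ p : Fin S × τ, ∑ ω : τ → Bool, ((⋂ t, (u t) ⁻¹' (if ω t then Iio (θ t * (1 - ρstar) ^ i) else Ici (θ t * (1 - ρstar) ^ i))) ∩ {x | p.2 ∈ tests p.1 (Nat.rec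
        (motive := fun _ => α) a₀ (fun σ a => next σ a ((tests σ a).filter fun t => ω t = true)) p.1) ∧ u p.2 x ∈ twoSidedShell (θ p.2) ρstar (ρ p.2) i}).indicator
            (1 : Ω → ℝ≥0∞) x ≤ ((∑ σ ∈ range S, ((tests σ (Nat.rec (motive := fun _ => α) a₀ (fun σ a => next σ a ((tests σ a).filter fun t => decide (u t x < θ t *
            (1 - ρstar) ^ i) = true)) σ)).filter fun t => u t x ∈ twoSidedShell (θ t) ρstar (ρ t) i).card : ℕ) : ℝ≥0∞) := by
  rw [Finset.sum_comm, Finset.sum_eq_single (fun t => decide (u t x < θ t * (1 - ρstar) ^ i))]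
  · calc ∑ p : Fin S × τ, ((⋂ t, (u t) ⁻¹' (if decide (u t x < θ t * (1 - ρstar) ^ i) then Iio (θ t * (1 - ρstar) ^ i) else Ici (θ t * (1 - ρstar) ^ i))) ∩ {z | p.2 ∈ tests p.1
      (Nat.rec (motive := fun _ => α) a₀ (fun σ a => next σ a ((tests σ a).filter fun t => decide (u t x < θ t * (1 - ρstar) ^ i) = true)) p.1) ∧ u p.2 z ∈ twoSidedShell
          (θ p.2) ρstar (ρ p.2) i}).indicator (1 : Ω → ℝ≥0∞) x
        ≤ ∑ p : Fin S × τ, (if p.2 ∈ tests p.1 (Nat.rec (motive := fun _ => α) a₀ (fun σ a => next σ a ((tests σ a).filter fun t => decide (u t x < θ t * (1 - ρstar) ^ i) =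
            true)) p.1) then
            (if u p.2 x ∈ twoSidedShell (θ p.2) ρstar (ρ p.2) i then (1 : ℝ≥0∞) else 0) else 0) := by
          refine sum_le_sum fun p _ => ?_
          refine (Set.indicator_le_indicator_of_subset Set.inter_subset_right (fun _ => zero_le_one) x).trans_eq ?_
          simp only [Set.indicator_apply, Set.mem_setOf_eq, ite_and]
      _ = ∑ σ : Fin S, ((((tests σ (Nat.rec (motive := fun _ => α) a₀ (fun σ a => next σ a ((tests σ a).filter fun t => decide (u t x < θ t * (1 - ρstar) ^ i) =
          true)) σ)).filter fun t => u t x ∈ twoSidedShell (θ t) ρstar (ρ t) i).card : ℕ) : ℝ≥0∞) := by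
          rw [Fintype.sum_prod_type]
          refine sum_congr rfl fun σ _ => ?_
          dsimp only
          rw [Finset.sum_ite_mem, Finset.univ_inter, Finset.natCast_card_filter]
      _ = ((∑ σ ∈ range S, ((tests σ (Nat.rec (motive := fun _ => α) a₀ (fun σ a => next σ a ((tests σ a).filter fun t => decide (u t x < θ t * (1 - ρstar) ^ i) =
          true)) σ)).filter fun t => u t x ∈ twoSidedShell (θ t) ρstar (ρ t) i).card : ℕ) : ℝ≥0∞) := by
          rw [Nat.cast_sum, ← Fin.sum_univ_eq_sum_range]
  · intro ω _ hne
    refine Finset.sum_eq_zero fun p _ => ?_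
    rw [Set.indicator_of_notMem]
    intro hx
    exact hne ((mem_cell_iff u _ ω x).1 hx.1)
  · intro h; exact absurd (Finset.mem_univ _) h

variable [MeasurableSpace Ω] [DecidableEq α] (P : Measure Ω) [IsProbabilityMeasure P]

/-- **THE CANDIDATE-SUMMED BOOKED-SHELL MASSES OF AN ADAPTIVE TREE UNDER ANY LAW**: for measurable `u_t`, `θ_t ≥ 0`, `0 ≤ ρ_t ≤ ρ⋆ ∈ [0,1]`, `#tests σ a ≤ ν_σ`:
`Σ_{i<n} Σ_{(σ,t)} Σ_ω P(cell_{i,ω} ∩ {t booked at σ on path(ω), u_t ∈ shell_{t,i}}) ≤ 2·∏_{σ<S}(ν_σ + 1) − 2` — the pointwise cascade of file 49 integrated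
(`T4ShellMeasure.candidateTotals_le_of_pointwise`). [folklore] -/
theorem candidateTotal_le (hu : ∀ t, Measurable (u t)) (hθ : ∀ t, 0 ≤ θ t) (h0 : ∀ t, 0 ≤ ρ t) {ρstar : ℝ} (hle : ∀ t, ρ t ≤ ρstar)
    (hs0 : 0 ≤ ρstar) (hs1 : ρstar ≤ 1) (ν : ℕ → ℕ) (hν : ∀ σ a, (tests σ a).card ≤ ν σ) (n : ℕ) :
    ∑ i ∈ range n, ∑ p : Fin S × τ, ∑ ω : τ → Bool, P.real ((⋂ t, (u t) ⁻¹' (if ω t then Iio (θ t * (1 - ρstar) ^ i) else Ici (θ t * (1 - ρstar) ^ i))) ∩ {x | p.2 ∈ tests p.1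
        (Nat.rec (motive := fun _ => α) a₀ (fun σ a => next σ a ((tests σ a).filter fun t => ω t = true)) p.1) ∧ u p.2 x ∈ twoSidedShell (θ p.2) ρstar (ρ p.2) i}) ≤
            ((2 * ∏ σ ∈ range S, (ν σ + 1) - 2 : ℕ) : ℝ) := by
  have hmeas : ∀ (i : ℕ) (p : Fin S × τ) (ω : τ → Bool), MeasurableSet ((⋂ t, (u t) ⁻¹' (if ω t then Iio (θ t * (1 - ρstar) ^ i) else Ici (θ t * (1 - ρstar) ^ i))) ∩
      {x | p.2 ∈ tests p.1 (Nat.rec (motive := fun _ => α) a₀ (fun σ a => next σ a ((tests σ a).filter fun t => ω t = true)) p.1) ∧ u p.2 x ∈ twoSidedShell (θ p.2) ρstar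
          (ρ p.2) i}) := by
    intro i p ω
    refine (measurableSet_cell hu _ ω).inter ?_
    rw [Set.setOf_and]
    exact (MeasurableSet.const _).inter ((hu p.2) measurableSet_Ico)
  have h := candidateTotals_le_of_pointwise P (n := n)
    (fun i => ∑ p : Fin S × τ, ∑ ω : τ → Bool, P.real ((⋂ t, (u t) ⁻¹' (if ω t then Iio (θ t * (1 - ρstar) ^ i) else Ici (θ t * (1 - ρstar) ^ i))) ∩ {x | p.2 ∈ tests p.1 (Nat.rec
        (motive := fun _ => α) a₀ (fun σ a => next σ a ((tests σ a).filter fun t => ω t = true)) p.1) ∧ u p.2 x ∈ twoSidedShell (θ p.2) ρstar (ρ p.2) i}))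
    (fun i x => ((∑ σ ∈ range S, ((tests σ (Nat.rec (motive := fun _ => α) a₀ (fun σ a => next σ a ((tests σ a).filter fun t => decide (u t x < θ t * (1 - ρstar) ^ i) =
        true)) σ)).filter fun t => u t x ∈ twoSidedShell (θ t) ρstar (ρ t) i).card : ℕ) : ℝ≥0∞)) ((2 * ∏ σ ∈ range S, (ν σ + 1) - 2 : ℕ) : NNReal) ?_ ?_
  · simpa only [measure_univ, ENNReal.toReal_one, mul_one, NNReal.coe_natCast] using h
  · intro x
    have hc := sum_card_shell_le_cascade tests next a₀ ν hν (fun t => u t x) θ ρ hθ h0 hle hs0 hs1 n S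
    have hc' : ∑ i ∈ range n, ∑ σ ∈ range S, ((tests σ (Nat.rec (motive := fun _ => α) a₀ (fun σ a => next σ a ((tests σ a).filter fun t => decide (u t x < θ t *
        (1 - ρstar) ^ i) = true)) σ)).filter fun t => u t x ∈ twoSidedShell (θ t) ρstar (ρ t) i).card ≤ 2 * ∏ σ ∈ range S, (ν σ + 1) - 2 := by omega
    rw [← Nat.cast_sum, ENNReal.coe_natCast]
    exact_mod_cast hc'
  · intro i _
    have hbd : ∀ x, ((∑ σ ∈ range S, ((tests σ (Nat.rec (motive := fun _ => α) a₀ (fun σ a => next σ a ((tests σ a).filter fun t => decide (u t x < θ t * (1 - ρstar) ^ i) =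
        true)) σ)).filter fun t => u t x ∈ twoSidedShell (θ t) ρstar (ρ t) i).card : ℕ) : ℝ≥0∞) ≤ ((∑ σ ∈ range S, ν σ : ℕ) : ℝ≥0∞) := by
      intro x
      have hnat : ∑ σ ∈ range S, ((tests σ (Nat.rec (motive := fun _ => α) a₀ (fun σ a => next σ a ((tests σ a).filter fun t => decide (u t x < θ t * (1 - ρstar) ^ i) =
          true)) σ)).filter fun t => u t x ∈ twoSidedShell (θ t) ρstar (ρ t) i).card ≤ ∑ σ ∈ range S, ν σ := Finset.sum_le_sum fun σ _ => (card_filter_le _ _).trans (hν σ _)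
      exact_mod_cast hnat
    have hfin : ∫⁻ x, ((∑ σ ∈ range S, ((tests σ (Nat.rec (motive := fun _ => α) a₀ (fun σ a => next σ a ((tests σ a).filter fun t => decide (u t x < θ t * (1 - ρstar) ^ i) =
        true)) σ)).filter fun t => u t x ∈ twoSidedShell (θ t) ρstar (ρ t) i).card : ℕ) : ℝ≥0∞) ∂P ≠ ∞ := by
      refine ne_top_of_le_ne_top ?_ (lintegral_mono hbd)
      rw [lintegral_const, measure_univ, mul_one]; exact ENNReal.natCast_ne_top _
    have hsum : (∑ p : Fin S × τ, ∑ ω : τ → Bool, P ((⋂ t, (u t) ⁻¹' (if ω t then Iio (θ t * (1 - ρstar) ^ i) else Ici (θ t * (1 - ρstar) ^ i))) ∩ {x | p.2 ∈ tests p.1 (Nat.rec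
        (motive := fun _ => α) a₀ (fun σ a => next σ a ((tests σ a).filter fun t => ω t = true)) p.1) ∧ u p.2 x ∈ twoSidedShell (θ p.2) ρstar (ρ p.2) i})).toReal =
        ∑ p : Fin S × τ, ∑ ω : τ → Bool, P.real ((⋂ t, (u t) ⁻¹' (if ω t then Iio (θ t * (1 - ρstar) ^ i) else Ici (θ t * (1 - ρstar) ^ i))) ∩ {x | p.2 ∈ tests p.1 (Nat.rec
            (motive := fun _ => α) a₀ (fun σ a => next σ a ((tests σ a).filter fun t => ω t = true)) p.1) ∧ u p.2 x ∈ twoSidedShell (θ p.2) ρstar (ρ p.2) i}) := by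
      rw [ENNReal.toReal_sum (fun p _ => ENNReal.sum_ne_top.2 fun ω _ => measure_ne_top P _)]
      refine sum_congr rfl fun p _ => ?_
      rw [ENNReal.toReal_sum (fun ω _ => measure_ne_top P _)]
      rfl
    rw [← hsum]
    refine ENNReal.toReal_mono hfin ?_
    calc ∑ p : Fin S × τ, ∑ ω : τ → Bool, P ((⋂ t, (u t) ⁻¹' (if ω t then Iio (θ t * (1 - ρstar) ^ i) else Ici (θ t * (1 - ρstar) ^ i))) ∩ {x | p.2 ∈ tests p.1 (Nat.rec
        (motive := fun _ => α) a₀ (fun σ a => next σ a ((tests σ a).filter fun t => ω t = true)) p.1) ∧ u p.2 x ∈ twoSidedShell (θ p.2) ρstar (ρ p.2) i})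
        = ∑ p : Fin S × τ, ∑ ω : τ → Bool, ∫⁻ x, ((⋂ t, (u t) ⁻¹' (if ω t then Iio (θ t * (1 - ρstar) ^ i) else Ici (θ t * (1 - ρstar) ^ i))) ∩ {x | p.2 ∈ tests p.1 (Nat.rec
            (motive := fun _ => α) a₀ (fun σ a => next σ a ((tests σ a).filter fun t => ω t = true)) p.1) ∧ u p.2 x ∈ twoSidedShell (θ p.2) ρstar (ρ p.2) i}).indicator
                (1 : Ω → ℝ≥0∞) x ∂P := by
          simp only [lintegral_indicator_one (hmeas i _ _)]
      _ = ∫⁻ x, ∑ p : Fin S × τ, ∑ ω : τ → Bool, ((⋂ t, (u t) ⁻¹' (if ω t then Iio (θ t * (1 - ρstar) ^ i) else Ici (θ t * (1 - ρstar) ^ i))) ∩ {x | p.2 ∈ tests p.1 (Nat.rec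
          (motive := fun _ => α) a₀ (fun σ a => next σ a ((tests σ a).filter fun t => ω t = true)) p.1) ∧ u p.2 x ∈ twoSidedShell (θ p.2) ρstar (ρ p.2) i}).indicator
              (1 : Ω → ℝ≥0∞) x ∂P := by
          rw [lintegral_finsetSum _ fun p _ => Finset.measurable_sum _ fun ω _ => (measurable_one.indicator (hmeas i p ω))]
          refine sum_congr rfl fun p _ => ?_
          rw [lintegral_finsetSum _ fun ω _ => measurable_one.indicator (hmeas i p ω)]
      _ ≤ ∫⁻ x, ((∑ σ ∈ range S, ((tests σ (Nat.rec (motive := fun _ => α) a₀ (fun σ a => next σ a ((tests σ a).filter fun t => decide (u t x < θ t * (1 - ρstar) ^ i) =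
          true)) σ)).filter fun t => u t x ∈ twoSidedShell (θ t) ρstar (ρ t) i).card : ℕ) : ℝ≥0∞) ∂P := lintegral_mono fun x => sum_indicator_le_count u θ ρ tests next a₀ i x

end Totals

/-! ## §4 ROAD (δ)'s CONSTRUCTOR FIRES ON ADAPTIVE DECISION TREES UNDER ANY JOINT LAW, `V = 2(∏_σ(ν_σ + 1) − 1)` -/

section AdaptiveTree

variable {α τ : Type*} [DecidableEq α] [Fintype τ] [DecidableEq τ] {S : ℕ}
  {ΩA ΩB : ℕ → Type*} [∀ K, MeasurableSpace (ΩA K)] [∀ K, MeasurableSpace (ΩB K)]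
  (PA : ∀ K, Measure (ΩA K)) (PB : ∀ K, Measure (ΩB K)) [∀ K, IsProbabilityMeasure (PA K)] [∀ K, IsProbabilityMeasure (PB K)]
  (uA : ∀ K, τ → ΩA K → ℝ) (uB : ∀ K, τ → ΩB K → ℝ) (θ ρA ρB : ℕ → τ → ℝ)
  (testsA testsB : ℕ → ℕ → α → Finset τ) (nextA nextB : ℕ → ℕ → α → Finset τ → α) (aA aB : ℕ → α) (ν : ℕ → ℕ)

/-- **ROAD (δ)'s END-TO-END CONSTRUCTOR FIRES ON ADAPTIVE DECISION TREES UNDER ANY JOINT LAW — reading (R) + count (W1) inhabited at MEASURE LEVEL in full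
generality.**  For every comparison `K`, run `X ∈ {A, B}` lives on ITS OWN probability space `(Ω^X_K, P^X_K)` (ANY) with measurable real observables `u^X_{K,t}`
indexed by a finite LABEL set `τ` (ARBITRARILY DEPENDENT), thresholds `θ_{K,t} ≥ 0`, radii `0 ≤ ρ^X_{K,t}`, `2ρ^X_{K,t} ≤ c₁ϑ^K` (`0 < c₁`, `2c₁ ≤ β′ ≤ 1`,
`0 < ϑ < 1`), and runs an ADAPTIVE decision tree through `S` live stages: dead prefix `a^X_K`, stage `σ` at older value `a` BOOKS the tests `tests^X_K σ a ⊆ τ`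
— AT MOST `ν_σ` OF THEM, `ν` INDEPENDENT OF `K` AND OF THE RUN (W1) — against `θ_{K,t}·(1 − c₁ϑ^K)^i`, and moves to `next^X_K σ a T` (`T` = the booked tests
reading small) (R).  TERMS = the cells of the outcome vectors `ω : τ → Bool` (file 47, generic index); slot `(σ, t)`'s piece on cell `ω` = the cell's mass on
«`t` booked at stage `σ` on the path of `ω` and `u_t` in its two-sided shell»; SHELL PART = the cell's mass on «some booked test of its path in its shell».
Then ONE choice function `i⋆` gives, for BOTH runs and every `K`, the total chosen booked-shell mass `Σ_{(σ,t)} Σ_ω P^X_K(cell_ω ∩ {t booked at σ on path(ω),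
u_t ∈ shell_{i⋆K}}) ≤ ((2∏_{σ<S}(ν_σ+1) − 2)·4c₁∕β′)·ϑ^K`, and `T4IndicatorShell.ShellWeightBound` BY NAME with `Wsh K` = the sum of the two (the tree's
constant `V = 2(∏_σ(ν_σ + 1) − 1)` of `T4ShellMeasure` §8, attained by file 39's tree; `V = S` for non-adaptive batteries, file 47); consumed of the laws:
σ-additivity only. [folklore] -/
theorem shellWeightBound_adaptiveTree (l₀ : ℝ) {c₁ β' ϑ : ℝ} (hc₁ : 0 < c₁) (h2 : 2 * c₁ ≤ β') (hβ1 : β' ≤ 1) (hϑ0 : 0 < ϑ) (hϑ1 : ϑ < 1)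
    (huA : ∀ K t, Measurable (uA K t)) (huB : ∀ K t, Measurable (uB K t)) (hθ : ∀ K t, 0 ≤ θ K t)
    (hA0 : ∀ K t, 0 ≤ ρA K t) (hA2 : ∀ K t, 2 * ρA K t ≤ c₁ * ϑ ^ K) (hB0 : ∀ K t, 0 ≤ ρB K t) (hB2 : ∀ K t, 2 * ρB K t ≤ c₁ * ϑ ^ K)
    (hνA : ∀ K σ a, (testsA K σ a).card ≤ ν σ) (hνB : ∀ K σ a, (testsB K σ a).card ≤ ν σ) :
    ∃ istar : ℕ → ℕ, (∀ K, istar K < ⌊β' / (c₁ * ϑ ^ K)⌋₊ ∧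
        ∑ p : Fin S × τ, ∑ ω : τ → Bool, (PA K).real ((⋂ t, (uA K t) ⁻¹' (if ω t then Iio (θ K t * (1 - c₁ * ϑ ^ K) ^ istar K) else Ici (θ K t * (1 - c₁ * ϑ ^ K) ^ istar K))) ∩
            {x | p.2 ∈ testsA K p.1 (Nat.rec (motive := fun _ => α) (aA K) (fun σ a => nextA K σ a ((testsA K σ a).filter fun t => ω t = true)) p.1) ∧ uA K p.2 x ∈ twoSidedShell
                (θ K p.2) (c₁ * ϑ ^ K) (ρA K p.2) (istar K)}) ≤
          (((2 * ∏ σ ∈ range S, (ν σ + 1) - 2 : ℕ) : ℝ) * (4 * c₁ / β')) * ϑ ^ K ∧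
        ∑ p : Fin S × τ, ∑ ω : τ → Bool, (PB K).real ((⋂ t, (uB K t) ⁻¹' (if ω t then Iio (θ K t * (1 - c₁ * ϑ ^ K) ^ istar K) else Ici (θ K t * (1 - c₁ * ϑ ^ K) ^ istar K))) ∩
            {x | p.2 ∈ testsB K p.1 (Nat.rec (motive := fun _ => α) (aB K) (fun σ a => nextB K σ a ((testsB K σ a).filter fun t => ω t = true)) p.1) ∧ uB K p.2 x ∈ twoSidedShell
                (θ K p.2) (c₁ * ϑ ^ K) (ρB K p.2) (istar K)}) ≤
          (((2 * ∏ σ ∈ range S, (ν σ + 1) - 2 : ℕ) : ℝ) * (4 * c₁ / β')) * ϑ ^ K) ∧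
      T4IndicatorShell.ShellWeightBound l₀ (fun _ => (univ : Finset (τ → Bool)))
        (fun K (_ : ℝ) (ω : τ → Bool) => (PA K).real (⋂ t, (uA K t) ⁻¹' (if ω t then Iio (θ K t * (1 - c₁ * ϑ ^ K) ^ istar K) else Ici (θ K t * (1 - c₁ * ϑ ^ K) ^ istar K))))
        (fun K (_ : ℝ) (ω : τ → Bool) => (PB K).real (⋂ t, (uB K t) ⁻¹' (if ω t then Iio (θ K t * (1 - c₁ * ϑ ^ K) ^ istar K) else Ici (θ K t * (1 - c₁ * ϑ ^ K) ^ istar K))))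
        (fun K (_ : ℝ) (ω : τ → Bool) => (PA K).real ((⋂ t, (uA K t) ⁻¹' (if ω t then Iio (θ K t * (1 - c₁ * ϑ ^ K) ^ istar K) else Ici (θ K t * (1 - c₁ * ϑ ^ K) ^ istar K))) ∩ ⋃
            p : Fin S × τ, {x | p.2 ∈ testsA K p.1 (Nat.rec (motive := fun _ => α) (aA K) (fun σ a => nextA K σ a ((testsA K σ a).filter fun t => ω t = true)) p.1) ∧
                uA K p.2 x ∈ twoSidedShell (θ K p.2) (c₁ * ϑ ^ K) (ρA K p.2) (istar K)}))
        (fun K (_ : ℝ) (ω : τ → Bool) => (PB K).real ((⋂ t, (uB K t) ⁻¹' (if ω t then Iio (θ K t * (1 - c₁ * ϑ ^ K) ^ istar K) else Ici (θ K t * (1 - c₁ * ϑ ^ K) ^ istar K))) ∩ ⋃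
            p : Fin S × τ, {x | p.2 ∈ testsB K p.1 (Nat.rec (motive := fun _ => α) (aB K) (fun σ a => nextB K σ a ((testsB K σ a).filter fun t => ω t = true)) p.1) ∧
                uB K p.2 x ∈ twoSidedShell (θ K p.2) (c₁ * ϑ ^ K) (ρB K p.2) (istar K)}))
        (fun K => ∑ p : Fin S × τ, ∑ ω : τ → Bool, (PA K).real ((⋂ t, (uA K t) ⁻¹' (if ω t then Iio (θ K t * (1 - c₁ * ϑ ^ K) ^ istar K) else Ici (θ K t *
            (1 - c₁ * ϑ ^ K) ^ istar K))) ∩ {x | p.2 ∈ testsA K p.1 (Nat.rec (motive := fun _ => α) (aA K) (fun σ a => nextA K σ a ((testsA K σ a).filter fun t => ω t =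
                true)) p.1) ∧ uA K p.2 x ∈ twoSidedShell (θ K p.2) (c₁ * ϑ ^ K) (ρA K p.2) (istar K)}) +
          ∑ p : Fin S × τ, ∑ ω : τ → Bool, (PB K).real ((⋂ t, (uB K t) ⁻¹' (if ω t then Iio (θ K t * (1 - c₁ * ϑ ^ K) ^ istar K) else Ici (θ K t * (1 - c₁ * ϑ ^ K) ^ istar K))) ∩
              {x | p.2 ∈ testsB K p.1 (Nat.rec (motive := fun _ => α) (aB K) (fun σ a => nextB K σ a ((testsB K σ a).filter fun t => ω t = true)) p.1) ∧
                  uB K p.2 x ∈ twoSidedShell (θ K p.2) (c₁ * ϑ ^ K) (ρB K p.2) (istar K)})) := by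
  have hs1 : ∀ K, c₁ * ϑ ^ K ≤ 1 := fun K => by
    have := mul_le_mul_of_nonneg_left (pow_le_one₀ hϑ0.le hϑ1.le : ϑ ^ K ≤ 1) hc₁.le
    linarith
  have hs0 : ∀ K, 0 ≤ c₁ * ϑ ^ K := fun K => (mul_pos hc₁ (pow_pos hϑ0 K)).le
  exact shellWeightBound_slots_of_totals
    (A := fun K i (ω : τ → Bool) => (PA K).real (⋂ t, (uA K t) ⁻¹' (if ω t then Iio (θ K t * (1 - c₁ * ϑ ^ K) ^ i) else Ici (θ K t * (1 - c₁ * ϑ ^ K) ^ i))))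
    (sh := fun K i (ω : τ → Bool) => (PA K).real ((⋂ t, (uA K t) ⁻¹' (if ω t then Iio (θ K t * (1 - c₁ * ϑ ^ K) ^ i) else Ici (θ K t * (1 - c₁ * ϑ ^ K) ^ i))) ∩ ⋃ p : Fin S × τ,
        {x | p.2 ∈ testsA K p.1 (Nat.rec (motive := fun _ => α) (aA K) (fun σ a => nextA K σ a ((testsA K σ a).filter fun t => ω t = true)) p.1) ∧ uA K p.2 x ∈ twoSidedShell
            (θ K p.2) (c₁ * ϑ ^ K) (ρA K p.2) i}))
    (piece := fun K i (p : Fin S × τ) (ω : τ → Bool) => (PA K).real ((⋂ t, (uA K t) ⁻¹' (if ω t then Iio (θ K t * (1 - c₁ * ϑ ^ K) ^ i) else Ici (θ K t * (1 - c₁ * ϑ ^ K) ^ i))) ∩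
        {x | p.2 ∈ testsA K p.1 (Nat.rec (motive := fun _ => α) (aA K) (fun σ a => nextA K σ a ((testsA K σ a).filter fun t => ω t = true)) p.1) ∧ uA K p.2 x ∈ twoSidedShell
            (θ K p.2) (c₁ * ϑ ^ K) (ρA K p.2) i}))
    (B := fun K i (ω : τ → Bool) => (PB K).real (⋂ t, (uB K t) ⁻¹' (if ω t then Iio (θ K t * (1 - c₁ * ϑ ^ K) ^ i) else Ici (θ K t * (1 - c₁ * ϑ ^ K) ^ i))))
    (shB := fun K i (ω : τ → Bool) => (PB K).real ((⋂ t, (uB K t) ⁻¹' (if ω t then Iio (θ K t * (1 - c₁ * ϑ ^ K) ^ i) else Ici (θ K t * (1 - c₁ * ϑ ^ K) ^ i))) ∩ ⋃ p : Fin S × τ,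
        {x | p.2 ∈ testsB K p.1 (Nat.rec (motive := fun _ => α) (aB K) (fun σ a => nextB K σ a ((testsB K σ a).filter fun t => ω t = true)) p.1) ∧ uB K p.2 x ∈ twoSidedShell
            (θ K p.2) (c₁ * ϑ ^ K) (ρB K p.2) i}))
    (pieceB := fun K i (p : Fin S × τ) (ω : τ → Bool) => (PB K).real ((⋂ t, (uB K t) ⁻¹' (if ω t then Iio (θ K t * (1 - c₁ * ϑ ^ K) ^ i) else Ici (θ K t *
        (1 - c₁ * ϑ ^ K) ^ i))) ∩ {x | p.2 ∈ testsB K p.1 (Nat.rec (motive := fun _ => α) (aB K) (fun σ a => nextB K σ a ((testsB K σ a).filter fun t => ω t = true)) p.1) ∧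
            uB K p.2 x ∈ twoSidedShell (θ K p.2) (c₁ * ϑ ^ K) (ρB K p.2) i}))
    l₀ hc₁ h2 hϑ0 hϑ1 (Nat.cast_nonneg _)
    (fun K i ω => measureReal_nonneg) (fun K i ω => measureReal_mono Set.inter_subset_left)
    (fun K i ω => measureReal_inter_iUnion_le (PA K) _ _) (fun K i p ω => measureReal_nonneg)
    (fun K i => sum_measureReal_cell (PA K) (huA K) _)
    (fun K => candidateTotal_le (uA K) (θ K) (ρA K) (testsA K) (nextA K) (aA K) (PA K) (huA K) (hθ K) (hA0 K)
      (fun t => by linarith [hA0 K t, hA2 K t]) (hs0 K) (hs1 K) ν (hνA K) _)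
    (fun K i ω => measureReal_nonneg) (fun K i ω => measureReal_mono Set.inter_subset_left)
    (fun K i ω => measureReal_inter_iUnion_le (PB K) _ _) (fun K i p ω => measureReal_nonneg)
    (fun K i => sum_measureReal_cell (PB K) (huB K) _)
    (fun K => candidateTotal_le (uB K) (θ K) (ρB K) (testsB K) (nextB K) (aB K) (PB K) (huB K) (hθ K) (hB0 K)
      (fun t => by linarith [hB0 K t, hB2 K t]) (hs0 K) (hs1 K) ν (hνB K) _)

end AdaptiveTree

/-! ## §5 The level-0 LATTICE instance of the adaptive model: ANY adaptive tree of plaquette tests on the Wilson–Gibbs fields of ANY torus scheme, step `K`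
against step `K + 1` -/

section Lattice

variable {α : Type*} [DecidableEq α] {τ : Type*} [Fintype τ] [DecidableEq τ] {S : ℕ}
  {G : Type*} [GaugeGroup G] [MeasurableSpace G] [RegularGaugeGroup G] [HaarData G] {O : Type*} (Sch : Missing.TorusScheme G O)
  (pA : ∀ K, τ → Plaq (Sch.P K) 0) (pB : ∀ K, τ → Plaq (Sch.P (K + 1)) 0) (θ ρA ρB : ℕ → τ → ℝ)
  (testsA testsB : ℕ → ℕ → α → Finset τ) (nextA nextB : ℕ → ℕ → α → Finset τ → α) (aA aB : ℕ → α) (ν : ℕ → ℕ)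

/-- **ROAD (δ)'s CONSTRUCTOR FIRES FOR EVERY ADAPTIVE TREE OF PLAQUETTE TESTS ON THE LATTICE.**  `G` any regular gauge group, `Sch` ANY `Missing.TorusScheme G O`
with `β_K ≥ 0`; run A = Wilson's Gibbs measure on `GaugeField (Sch.P K) 0 G`, run B = the same at step `K + 1`; test label `t ∈ τ` tests the plaquette action
density `1 − Re tr U(∂p^X_{K,t})` of its plaquette `p^X_K t`; each run books its tests through ITS OWN ADAPTIVE TREE (at most `ν_σ` per stage given the history —
e.g. «test the plaquettes of the blocks not yet declared large», any rule).  Conclusion: §4 BY NAME — ONE common live factor per `K`, both runs' chosen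
booked-shell mass `≤ ((2∏_{σ<S}(ν_σ+1) − 2)·4c₁∕β′)·ϑ^K`, `T4IndicatorShell.ShellWeightBound`.  MODEL: the tree is ARBITRARY, not Bałaban's (node O). [folklore] -/
theorem shellWeightBound_wilsonScheme_adaptive (hβ : ∀ K, 0 ≤ Sch.β K) (l₀ : ℝ) {c₁ β' ϑ : ℝ} (hc₁ : 0 < c₁) (h2 : 2 * c₁ ≤ β') (hβ1 : β' ≤ 1)
    (hϑ0 : 0 < ϑ) (hϑ1 : ϑ < 1) (hθ : ∀ K t, 0 ≤ θ K t)
    (hA0 : ∀ K t, 0 ≤ ρA K t) (hA2 : ∀ K t, 2 * ρA K t ≤ c₁ * ϑ ^ K) (hB0 : ∀ K t, 0 ≤ ρB K t) (hB2 : ∀ K t, 2 * ρB K t ≤ c₁ * ϑ ^ K)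
    (hνA : ∀ K σ a, (testsA K σ a).card ≤ ν σ) (hνB : ∀ K σ a, (testsB K σ a).card ≤ ν σ) :
    ∃ istar : ℕ → ℕ, (∀ K, istar K < ⌊β' / (c₁ * ϑ ^ K)⌋₊ ∧
        ∑ p : Fin S × τ, ∑ ω : τ → Bool, (T4GenFunBounds.gibbsMeasure (G := G) (Sch.P K) (Sch.β K)).real ((⋂ t, (fun U : GaugeField (Sch.P K) 0 G => 1 - Missing.plaqLoop
            (pA K t) U) ⁻¹' (if ω t then Iio (θ K t * (1 - c₁ * ϑ ^ K) ^ istar K) else Ici (θ K t * (1 - c₁ * ϑ ^ K) ^ istar K))) ∩ {x | p.2 ∈ testsA K p.1 (Nat.rec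
                (motive := fun _ => α) (aA K) (fun σ a => nextA K σ a ((testsA K σ a).filter fun t => ω t = true)) p.1) ∧ (fun U : GaugeField (Sch.P K) 0 G =>
                1 - Missing.plaqLoop (pA K p.2) U) x ∈ twoSidedShell (θ K p.2) (c₁ * ϑ ^ K) (ρA K p.2) (istar K)}) ≤
          (((2 * ∏ σ ∈ range S, (ν σ + 1) - 2 : ℕ) : ℝ) * (4 * c₁ / β')) * ϑ ^ K ∧
        ∑ p : Fin S × τ, ∑ ω : τ → Bool, (T4GenFunBounds.gibbsMeasure (G := G) (Sch.P (K + 1)) (Sch.β (K + 1))).real ((⋂ t, (fun U : GaugeField (Sch.P (K + 1)) 0 G =>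
            1 - Missing.plaqLoop (pB K t) U) ⁻¹' (if ω t then Iio (θ K t * (1 - c₁ * ϑ ^ K) ^ istar K) else Ici (θ K t * (1 - c₁ * ϑ ^ K) ^ istar K))) ∩ {x | p.2 ∈ testsB K p.1
                (Nat.rec (motive := fun _ => α) (aB K) (fun σ a => nextB K σ a ((testsB K σ a).filter fun t => ω t = true)) p.1) ∧ (fun U : GaugeField (Sch.P (K + 1)) 0 G =>
                1 - Missing.plaqLoop (pB K p.2) U) x ∈ twoSidedShell (θ K p.2) (c₁ * ϑ ^ K) (ρB K p.2) (istar K)}) ≤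
          (((2 * ∏ σ ∈ range S, (ν σ + 1) - 2 : ℕ) : ℝ) * (4 * c₁ / β')) * ϑ ^ K) ∧
      T4IndicatorShell.ShellWeightBound l₀ (fun _ => (univ : Finset (τ → Bool)))
        (fun K (_ : ℝ) (ω : τ → Bool) => (T4GenFunBounds.gibbsMeasure (G := G) (Sch.P K) (Sch.β K)).real (⋂ t, (fun U : GaugeField (Sch.P K) 0 G => 1 - Missing.plaqLoop
            (pA K t) U) ⁻¹' (if ω t then Iio (θ K t * (1 - c₁ * ϑ ^ K) ^ istar K) else Ici (θ K t * (1 - c₁ * ϑ ^ K) ^ istar K))))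
        (fun K (_ : ℝ) (ω : τ → Bool) => (T4GenFunBounds.gibbsMeasure (G := G) (Sch.P (K + 1)) (Sch.β (K + 1))).real (⋂ t, (fun U : GaugeField (Sch.P (K + 1)) 0 G =>
            1 - Missing.plaqLoop (pB K t) U) ⁻¹' (if ω t then Iio (θ K t * (1 - c₁ * ϑ ^ K) ^ istar K) else Ici (θ K t * (1 - c₁ * ϑ ^ K) ^ istar K))))
        (fun K (_ : ℝ) (ω : τ → Bool) => (T4GenFunBounds.gibbsMeasure (G := G) (Sch.P K) (Sch.β K)).real ((⋂ t, (fun U : GaugeField (Sch.P K) 0 G => 1 - Missing.plaqLoop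
            (pA K t) U) ⁻¹' (if ω t then Iio (θ K t * (1 - c₁ * ϑ ^ K) ^ istar K) else Ici (θ K t * (1 - c₁ * ϑ ^ K) ^ istar K))) ∩ ⋃ p : Fin S × τ, {x | p.2 ∈ testsA K p.1
                (Nat.rec (motive := fun _ => α) (aA K) (fun σ a => nextA K σ a ((testsA K σ a).filter fun t => ω t = true)) p.1) ∧ (fun U : GaugeField (Sch.P K) 0 G =>
                1 - Missing.plaqLoop (pA K p.2) U) x ∈ twoSidedShell (θ K p.2) (c₁ * ϑ ^ K) (ρA K p.2) (istar K)}))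
        (fun K (_ : ℝ) (ω : τ → Bool) => (T4GenFunBounds.gibbsMeasure (G := G) (Sch.P (K + 1)) (Sch.β (K + 1))).real ((⋂ t, (fun U : GaugeField (Sch.P (K + 1)) 0 G =>
            1 - Missing.plaqLoop (pB K t) U) ⁻¹' (if ω t then Iio (θ K t * (1 - c₁ * ϑ ^ K) ^ istar K) else Ici (θ K t * (1 - c₁ * ϑ ^ K) ^ istar K))) ∩ ⋃ p : Fin S × τ,
                {x | p.2 ∈ testsB K p.1 (Nat.rec (motive := fun _ => α) (aB K) (fun σ a => nextB K σ a ((testsB K σ a).filter fun t => ω t = true)) p.1) ∧ (fun U : GaugeField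
                (Sch.P (K + 1)) 0 G => 1 - Missing.plaqLoop (pB K p.2) U) x ∈ twoSidedShell (θ K p.2) (c₁ * ϑ ^ K) (ρB K p.2) (istar K)}))
        (fun K => ∑ p : Fin S × τ, ∑ ω : τ → Bool, (T4GenFunBounds.gibbsMeasure (G := G) (Sch.P K) (Sch.β K)).real ((⋂ t, (fun U : GaugeField (Sch.P K) 0 G =>
            1 - Missing.plaqLoop (pA K t) U) ⁻¹' (if ω t then Iio (θ K t * (1 - c₁ * ϑ ^ K) ^ istar K) else Ici (θ K t * (1 - c₁ * ϑ ^ K) ^ istar K))) ∩ {x | p.2 ∈ testsA K p.1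
                (Nat.rec (motive := fun _ => α) (aA K) (fun σ a => nextA K σ a ((testsA K σ a).filter fun t => ω t = true)) p.1) ∧ (fun U : GaugeField (Sch.P K) 0 G =>
                1 - Missing.plaqLoop (pA K p.2) U) x ∈ twoSidedShell (θ K p.2) (c₁ * ϑ ^ K) (ρA K p.2) (istar K)}) +
          ∑ p : Fin S × τ, ∑ ω : τ → Bool, (T4GenFunBounds.gibbsMeasure (G := G) (Sch.P (K + 1)) (Sch.β (K + 1))).real ((⋂ t, (fun U : GaugeField (Sch.P (K + 1)) 0 G =>
              1 - Missing.plaqLoop (pB K t) U) ⁻¹' (if ω t then Iio (θ K t * (1 - c₁ * ϑ ^ K) ^ istar K) else Ici (θ K t * (1 - c₁ * ϑ ^ K) ^ istar K))) ∩ {x | p.2 ∈ testsB K p.1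
                  (Nat.rec (motive := fun _ => α) (aB K) (fun σ a => nextB K σ a ((testsB K σ a).filter fun t => ω t = true)) p.1) ∧ (fun U : GaugeField (Sch.P (K + 1)) 0 G =>
                  1 - Missing.plaqLoop (pB K p.2) U) x ∈ twoSidedShell (θ K p.2) (c₁ * ϑ ^ K) (ρB K p.2) (istar K)})) := by
  haveI : ∀ K, IsProbabilityMeasure (T4GenFunBounds.gibbsMeasure (G := G) (Sch.P K) (Sch.β K)) := fun K => T4GenFunBounds.isProbabilityMeasure_gibbsMeasure _ (hβ K)
  haveI : ∀ K, IsProbabilityMeasure (T4GenFunBounds.gibbsMeasure (G := G) (Sch.P (K + 1)) (Sch.β (K + 1))) := fun K => T4GenFunBounds.isProbabilityMeasure_gibbsMeasure _ (hβ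
      (K + 1))
  exact shellWeightBound_adaptiveTree (ΩA := fun K => GaugeField (Sch.P K) 0 G) (ΩB := fun K => GaugeField (Sch.P (K + 1)) 0 G)
    (fun K => T4GenFunBounds.gibbsMeasure (G := G) (Sch.P K) (Sch.β K)) (fun K => T4GenFunBounds.gibbsMeasure (G := G) (Sch.P (K + 1)) (Sch.β (K + 1)))
    (fun K t (U : GaugeField (Sch.P K) 0 G) => 1 - Missing.plaqLoop (pA K t) U)
    (fun K t (U : GaugeField (Sch.P (K + 1)) 0 G) => 1 - Missing.plaqLoop (pB K t) U) θ ρA ρB testsA testsB nextA nextB aA aB ν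
    l₀ hc₁ h2 hβ1 hϑ0 hϑ1
    (fun K t => measurable_const.sub (Missing.measurable_plaqLoop' (pA K t)))
    (fun K t => measurable_const.sub (Missing.measurable_plaqLoop' (pB K t))) hθ hA0 hA2 hB0 hB2 hνA hνB

end Lattice




end Summit.QuantumFields.BalabanUV.T4Continuum.Spine.NE7c.LiveFactorAdaptiveTreeModel

end
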